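import Summits.AtomisticToContinuum.HydrodynamicLimit.Theorems.JParityClosureLocalSecondLawContactDefs

/-!
# Stub B′ (`stub_initialMatching`) of the line `contact-asymmetry-information` for the crux `LocalSecondLaw`
(stmt-AtomisticToContinuum-13081) — part 1: the conditioned law and the time-zero structure

Registered sub-lemmas of stub B′ (initial matching: conditioning lemma + `t = 0` law of large numbers), over the
landed ensemble vocabulary `Theorems/JParityClosureLocalSecondLawContactDefs.lean` (`condLaw`, `rhoBar`,
`IsOneParticleDensity`, `Pt1`).

* The CONDITIONED LAW `condLaw μ S = (μ S)⁻¹ • μ|_S` is a bounded tilt: `condLaw μ S ≤ (μ S)⁻¹ • μ`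
  (`contactB_condLaw_le_smul`), `condLaw μ S ≪ μ` (`contactB_condLaw_absolutelyContinuous`), event-wise
  `μ(A|S) ≤ μ(A)/μ(S)` (`contactB_condLaw_apply_le`), a probability measure for `0 < μ S < ∞`
  (`contactB_condLaw_isProbability`, `…_of_floor` under the frame's mass floor `ENNReal.ofReal δ″ ≤ μ S`), and the
  two transfer rules of the conditioning step: small events stay small (`contactB_condLaw_apply_le_of_le`,
  `…_of_floor`: `μ A ≤ ofReal (ε δ″) ⇒ μ(A|S) ≤ ofReal ε`) and expectations are `(μ S)⁻¹ ∫_S` (`contactB_condLaw_integral`,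
  `contactB_condLaw_integral_le`); plus the generic bounded-observable transfer `|E_ν F − c| ≤ ε + (M + |c|) ν(B)`
  (`contactB_abs_integral_sub_le`).
* TIME-ZERO STRUCTURE: the local Gibbs law is `≪` Liouville, so under every conditioned local Gibbs law a.e. point is
  good and `Φ₀ = id` a.s. (`contactB_flow_zero_ae_condLaw`); hence `ρ̄(0,x) = E_ν[ρ_r(z)(x)]` (`contactB_rhoBar_zero`), the
  `s = 0` slice of any one-particle density `f` of `ν` is the density of the one-particle INTENSITY measure of `ν`
  itself (`contactB_onePt_zero`, unit mass `contactB_onePt_zero_mass`), and the mean coarse density at `s = 0` is the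
  cone-smeared one-particle density `ρ̄(0,x) = ∫∫ b_r(y,x) f(0,y,v)` (`contactB_rhoBar_zero_eq_integral_onePt`).

References: H. Spohn, *Large Scale Dynamics of Interacting Particles* (1991), Part I §2.3–§3 (local equilibrium,
bounded tilts); I. Csiszár, Ann. Probab. 3 (1975) 146 (conditioning and relative entropy).
-/

noncomputable section

open scoped BigOperators Topology Classical MeasureTheory ENNReal InnerProductSpace
open Filter Set MeasureTheory Function
open Literature.MathematicalPhysics.KineticTheory
open Literature.Analysis.FluidPDE
open Summit.AtomisticToContinuum.HydrodynamicLimit.Theorems.LocalSecondLawNegative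
open Summit.AtomisticToContinuum.HydrodynamicLimit.Theorems.LocalSecondLawLedger

namespace Summit.AtomisticToContinuum.HydrodynamicLimit.Theorems.LocalSecondLawContact

/-! ## B′ sub-lemmas: the conditioned law `condLaw μ S = (μ S)⁻¹ • μ|_S` -/

/-- The conditioned law is dominated by the bounded tilt `(μ S)⁻¹ • μ` (as measures). -/
theorem contactB_condLaw_le_smul :
    ∀ {N : ℕ} (μ : Measure (Phase N)) (S : Set (Phase N)), condLaw μ S ≤ (μ S)⁻¹ • μ :=
  fun μ S => show (μ S)⁻¹ • μ.restrict S ≤ (μ S)⁻¹ • μ from smul_le_smul_left (μ S)⁻¹ Measure.restrict_le_self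

/-- The conditioned law is absolutely continuous with respect to the law. -/
theorem contactB_condLaw_absolutelyContinuous :
    ∀ {N : ℕ} (μ : Measure (Phase N)) (S : Set (Phase N)), condLaw μ S ≪ μ :=
  fun _ _ => Measure.smul_absolutelyContinuous.trans Measure.restrict_le_self.absolutelyContinuous

/-- Event-wise domination: `μ(A | S) ≤ μ(A) / μ(S)`. -/
theorem contactB_condLaw_apply_le :
    ∀ {N : ℕ} (μ : Measure (Phase N)) (S A : Set (Phase N)), condLaw μ S A ≤ (μ S)⁻¹ * μ A := by
  intro N μ S A
  show ((μ S)⁻¹ • μ.restrict S) A ≤ (μ S)⁻¹ * μ A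
  rw [Measure.smul_apply, smul_eq_mul]
  exact mul_le_mul_right (Measure.restrict_apply_le S A) _

/-- The conditioned law of a cell of positive finite mass is a probability measure. -/
theorem contactB_condLaw_isProbability :
    ∀ {N : ℕ} (μ : Measure (Phase N)) (S : Set (Phase N)), μ S ≠ 0 → μ S ≠ ⊤ →
      IsProbabilityMeasure (condLaw μ S) := by
  intro N μ S h0 htop
  refine ⟨?_⟩
  show ((μ S)⁻¹ • μ.restrict S) Set.univ = 1
  rw [Measure.smul_apply, smul_eq_mul, Measure.restrict_apply MeasurableSet.univ, Set.univ_inter,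
    ENNReal.inv_mul_cancel h0 htop]

/-- In the frame of the line: under a probability law, a cell with mass floor `ENNReal.ofReal δ″ ≤ μ S`, `0 < δ″`,
has a conditioned law that is a probability measure. -/
theorem contactB_condLaw_isProbability_of_floor :
    ∀ {N : ℕ} (μ : Measure (Phase N)) [IsFiniteMeasure μ] (S : Set (Phase N)) (δ'' : ℝ), 0 < δ'' →
      ENNReal.ofReal δ'' ≤ μ S → IsProbabilityMeasure (condLaw μ S) := by
  intro N μ _ S δ'' hδ hS
  refine contactB_condLaw_isProbability μ S ?_ (measure_ne_top μ S)
  exact (lt_of_lt_of_le (ENNReal.ofReal_pos.2 hδ) hS).ne'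

/-- Transfer of small events: `μ A ≤ ε · μ S` forces `μ(A | S) ≤ ε` (for `0 < μ S < ∞`). -/
theorem contactB_condLaw_apply_le_of_le :
    ∀ {N : ℕ} (μ : Measure (Phase N)) (S A : Set (Phase N)) (ε : ℝ), μ S ≠ 0 → μ S ≠ ⊤ →
      μ A ≤ ENNReal.ofReal ε * μ S → condLaw μ S A ≤ ENNReal.ofReal ε := by
  intro N μ S A ε h0 htop hA
  calc condLaw μ S A ≤ (μ S)⁻¹ * μ A := contactB_condLaw_apply_le μ S A
    _ ≤ (μ S)⁻¹ * (ENNReal.ofReal ε * μ S) := mul_le_mul_right hA _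
    _ = ENNReal.ofReal ε := by
        rw [mul_comm (ENNReal.ofReal ε), ← mul_assoc, ENNReal.inv_mul_cancel h0 htop, one_mul]

/-- Transfer of small events in the frame of the line: with the mass floor `ENNReal.ofReal δ″ ≤ μ S` (`0 < δ″`,
`μ` finite), an event of law-mass `≤ ENNReal.ofReal (ε δ″)` has conditioned mass `≤ ENNReal.ofReal ε`. -/
theorem contactB_condLaw_apply_le_of_floor :
    ∀ {N : ℕ} (μ : Measure (Phase N)) [IsFiniteMeasure μ] (S A : Set (Phase N)) (ε δ'' : ℝ), 0 ≤ ε → 0 < δ'' →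
      ENNReal.ofReal δ'' ≤ μ S → μ A ≤ ENNReal.ofReal (ε * δ'') → condLaw μ S A ≤ ENNReal.ofReal ε := by
  intro N μ _ S A ε δ'' hε hδ hS hA
  have h0 : μ S ≠ 0 := (lt_of_lt_of_le (ENNReal.ofReal_pos.2 hδ) hS).ne'
  refine contactB_condLaw_apply_le_of_le μ S A ε h0 (measure_ne_top μ S) (hA.trans ?_)
  rw [ENNReal.ofReal_mul hε]
  exact mul_le_mul_right hS _

/-- Expectations under the conditioned law: `E_{μ(·|S)}[F] = (μ S)⁻¹ ∫_S F dμ` (Bochner; both sides junk `0`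
together). -/
theorem contactB_condLaw_integral :
    ∀ {N : ℕ} (μ : Measure (Phase N)) (S : Set (Phase N)) (F : Phase N → ℝ),
      ∫ z, F z ∂(condLaw μ S) = ((μ S)⁻¹).toReal * ∫ z in S, F z ∂μ := by
  intro N μ S F
  show ∫ z, F z ∂((μ S)⁻¹ • μ.restrict S) = ((μ S)⁻¹).toReal * ∫ z in S, F z ∂μ
  rw [integral_smul_measure, smul_eq_mul]

/-- Domination of non-negative expectations: `E_{μ(·|S)}[F] ≤ (μ S)⁻¹ E_μ[F]` for `0 ≤ F` integrable under `μ`. -/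
theorem contactB_condLaw_integral_le :
    ∀ {N : ℕ} (μ : Measure (Phase N)) (S : Set (Phase N)) (F : Phase N → ℝ), 0 ≤ F → Integrable F μ →
      ∫ z, F z ∂(condLaw μ S) ≤ ((μ S)⁻¹).toReal * ∫ z, F z ∂μ := by
  intro N μ S F hF hFi
  rw [contactB_condLaw_integral]
  exact mul_le_mul_of_nonneg_left (setIntegral_le_integral hFi (Eventually.of_forall hF)) ENNReal.toReal_nonneg

/-- **Transfer of a uniform bound off a bad event** (the conditioning step of B′ for BOUNDED observables): if
`ν` is a probability measure, `|F| ≤ M` everywhere, `F` is a.e.-strongly measurable and `|F z − c| ≤ ε` off `B`,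
then `|E_ν[F] − c| ≤ ε + (M + |c|) ν(B)`. -/
theorem contactB_abs_integral_sub_le :
    ∀ {N : ℕ} (ν : Measure (Phase N)) [IsProbabilityMeasure ν] (F : Phase N → ℝ) (B : Set (Phase N))
      (M c ε : ℝ), AEStronglyMeasurable F ν → (∀ z, |F z| ≤ M) → 0 ≤ ε → (∀ z, z ∉ B → |F z - c| ≤ ε) →
      MeasurableSet B → |∫ z, F z ∂ν - c| ≤ ε + (M + |c|) * (ν B).toReal := by
  intro N ν _ F B M c ε hFm hFM hε hB hBm
  have hM0 : 0 ≤ M := (abs_nonneg _).trans (hFM (Classical.arbitrary _))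
  have hFi : Integrable F ν := Integrable.of_bound hFm M (Eventually.of_forall fun z => by
    rw [Real.norm_eq_abs]; exact hFM z)
  have hsub : ∫ z, F z ∂ν - c = ∫ z, (F z - c) ∂ν := by
    rw [integral_sub hFi (integrable_const c), integral_const, probReal_univ, one_smul]
  rw [hsub]
  have hpt : ∀ z, |F z - c| ≤ ε + (M + |c|) * B.indicator (fun _ => (1 : ℝ)) z := by
    intro z
    by_cases hz : z ∈ B
    · rw [Set.indicator_of_mem hz, mul_one]
      calc |F z - c| ≤ |F z| + |c| := abs_sub _ _
        _ ≤ M + |c| := by gcongr; exact hFM z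
        _ ≤ ε + (M + |c|) := by linarith
    · rw [Set.indicator_of_notMem hz, mul_zero, add_zero]
      exact hB z hz
  have hgi : Integrable (fun z => ε + (M + |c|) * B.indicator (fun _ => (1 : ℝ)) z) ν :=
    (integrable_const ε).add (((integrable_const (1 : ℝ)).indicator hBm).const_mul _)
  calc |∫ z, (F z - c) ∂ν| ≤ ∫ z, |F z - c| ∂ν := abs_integral_le_integral_abs
    _ ≤ ∫ z, (ε + (M + |c|) * B.indicator (fun _ => (1 : ℝ)) z) ∂ν :=
        integral_mono (hFi.sub (integrable_const c)).abs hgi hpt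
    _ = ε + (M + |c|) * (ν B).toReal := by
        rw [integral_add (integrable_const ε) (((integrable_const (1 : ℝ)).indicator hBm).const_mul _),
          integral_const, probReal_univ, one_smul, integral_const_mul,
          integral_indicator_const _ hBm, smul_eq_mul, mul_one, Measure.real]




/-! ## B′ sub-lemmas: the time-zero structure of the conditioned local Gibbs law -/

/-- The local Gibbs law is absolutely continuous with respect to the Liouville measure (it is `particleLaw`, a
`withDensity` of it). -/
theorem contactB_localGibbsLaw_absolutelyContinuous :
    ∀ {N : ℕ} (σ : ℝ) (a₀ θ₀ : T3 → ℝ) (u₀ : T3 → V3) (Φ : Flow σ N),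
      localGibbsLaw σ a₀ u₀ θ₀ N Φ ≪ liouville (Torus.geometry (Fin 3)) (N + 1) (hsDiameter σ N) :=
  fun _ _ _ _ _ => withDensity_absolutelyContinuous _ _

/-- Under every conditioned local Gibbs law almost every phase point is good for the flow (the good set is
Liouville-conull, `HardSphereFlow.measure_compl_good`). -/
theorem contactB_ae_mem_good_condLaw :
    ∀ {N : ℕ} (σ : ℝ) (a₀ θ₀ : T3 → ℝ) (u₀ : T3 → V3) (Φ : Flow σ N) (S : Set (Phase N)),
      ∀ᵐ z ∂(condLaw (localGibbsLaw σ a₀ u₀ θ₀ N Φ) S), z ∈ Φ.good :=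
  fun σ a₀ θ₀ u₀ Φ S =>
    ((contactB_condLaw_absolutelyContinuous _ S).trans
      (contactB_localGibbsLaw_absolutelyContinuous σ a₀ θ₀ u₀ Φ)).ae_le Φ.ae_mem_good

/-- `Φ₀ = id` almost surely under every conditioned local Gibbs law (`HardSphereFlow.flow_zero` on the good set). -/
theorem contactB_flow_zero_ae_condLaw :
    ∀ {N : ℕ} (σ : ℝ) (a₀ θ₀ : T3 → ℝ) (u₀ : T3 → V3) (Φ : Flow σ N) (S : Set (Phase N)),
      ∀ᵐ z ∂(condLaw (localGibbsLaw σ a₀ u₀ θ₀ N Φ) S), Φ.flow 0 z = z := by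
  intro N σ a₀ θ₀ u₀ Φ S
  filter_upwards [contactB_ae_mem_good_condLaw σ a₀ θ₀ u₀ Φ S] with z hz
  exact Φ.flow_zero z hz

/-- At `s = 0` the mean coarse density of a conditioned local Gibbs law is the plain expectation of `ρ_r` (no flow). -/
theorem contactB_rhoBar_zero :
    ∀ {N : ℕ} (σ r : ℝ) (a₀ θ₀ : T3 → ℝ) (u₀ : T3 → V3) (Φ : Flow σ N) (S : Set (Phase N)) (x : T3),
      rhoBar r (condLaw (localGibbsLaw σ a₀ u₀ θ₀ N Φ) S) Φ 0 x =
        ∫ z, rhoC r z x ∂(condLaw (localGibbsLaw σ a₀ u₀ θ₀ N Φ) S) := by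
  intro N σ r a₀ θ₀ u₀ Φ S x
  unfold rhoBar
  refine integral_congr_ae ?_
  filter_upwards [contactB_flow_zero_ae_condLaw σ a₀ θ₀ u₀ Φ S] with z hz
  rw [hz]

/-- **Time-zero identification of the one-particle density.** If `f` is a one-particle density of `ν` along `Φ`
on `[0,τ]` (`0 ≤ τ`) and `Φ₀ = id` `ν`-a.s., then `f(0,·)` is the density of the one-particle INTENSITY measure of
`ν` itself: `E_ν[(N+1)⁻¹ ∑ᵢ G(zᵢ)] = ∫ G f(0,·)` for bounded measurable `G` (with integrability). -/
theorem contactB_onePt_zero :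
    ∀ {N : ℕ} {σ τ : ℝ} (ν : Measure (Phase N)) (Φ : Flow σ N) (f : Pt1 → ℝ), 0 ≤ τ →
      IsOneParticleDensity τ ν Φ f → (∀ᵐ z ∂ν, Φ.flow 0 z = z) →
      ∀ G : T3 × V3 → ℝ, Measurable G → (∃ C : ℝ, ∀ y, |G y| ≤ C) →
        Integrable (fun z => (N + 1 : ℝ)⁻¹ * ∑ i : Fin (N + 1), G (z i)) ν ∧
          ∫ z, ((N + 1 : ℝ)⁻¹ * ∑ i : Fin (N + 1), G (z i)) ∂ν = ∫ y : T3 × V3, G y * f (0, y) := by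
  intro N σ τ ν Φ f hτ hf h0 G hGm hGb
  obtain ⟨hi, he⟩ := hf.2.2 0 ⟨le_rfl, hτ⟩ G hGm hGb
  have hae : (fun z => (N + 1 : ℝ)⁻¹ * ∑ i : Fin (N + 1), G (Φ.flow 0 z i)) =ᵐ[ν]
      fun z => (N + 1 : ℝ)⁻¹ * ∑ i : Fin (N + 1), G (z i) := by
    filter_upwards [h0] with z hz
    rw [hz]
  exact ⟨hi.congr hae, by rw [← integral_congr_ae hae, he]⟩

/-- The time-zero slice of a one-particle density of a PROBABILITY law has unit mass (test function `G ≡ 1`). -/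
theorem contactB_onePt_zero_mass :
    ∀ {N : ℕ} {σ τ : ℝ} (ν : Measure (Phase N)) [IsProbabilityMeasure ν] (Φ : Flow σ N) (f : Pt1 → ℝ), 0 ≤ τ →
      IsOneParticleDensity τ ν Φ f → ∫ y : T3 × V3, f (0, y) = 1 := by
  intro N σ τ ν _ Φ f hτ hf
  obtain ⟨-, he⟩ := hf.2.2 0 ⟨le_rfl, hτ⟩ (fun _ => 1) measurable_const ⟨1, fun _ => by simp⟩
  have hN1 : (N + 1 : ℝ) ≠ 0 := by positivity
  have hN : (N + 1 : ℝ)⁻¹ * ∑ _i : Fin (N + 1), (1 : ℝ) = 1 := by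
    rw [Finset.sum_const, Finset.card_univ, Fintype.card_fin, nsmul_eq_mul, mul_one]
    push_cast
    exact inv_mul_cancel₀ hN1
  simp only [hN, integral_const, probReal_univ, smul_eq_mul, mul_one, one_mul] at he
  exact he.symm

/-- The cone kernel is continuous in the particle position (symmetry of the minimal-image distance). -/
theorem contactB_continuous_cone_left : ∀ (r : ℝ) (x : T3), Continuous fun y : T3 => cone r y x := by
  intro r x
  have h : (fun y => cone r y x) = cone r x := by
    funext y
    unfold cone
    rw [Torus.euclidDist_comm]
  rw [h]
  exact continuous_cone r x

/-- The cone kernel is bounded by `3/(π r³)`. -/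
theorem contactB_cone_le_const : ∀ {r : ℝ}, 0 < r → ∀ y x : T3, cone r y x ≤ 3 / (Real.pi * r ^ 3) := by
  intro r hr y x
  refine (cone_le hr y x).trans (mul_le_of_le_one_right (by positivity) ?_)
  by_cases h : x ∈ {x' | Torus.euclidDist x' y < r}
  · rw [Set.indicator_of_mem h]
  · rw [Set.indicator_of_notMem h]; exact zero_le_one

/-- **The mean coarse density at `s = 0` is the cone-smeared one-particle density**:
`ρ̄(0, x) = ∫∫ b_r(y, x) f(0, y, v) dy dv` for every one-particle density `f` of a conditioned local Gibbs law
(`0 < r`, `0 ≤ τ`). -/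
theorem contactB_rhoBar_zero_eq_integral_onePt :
    ∀ {N : ℕ} {σ τ r : ℝ} (a₀ θ₀ : T3 → ℝ) (u₀ : T3 → V3) (Φ : Flow σ N) (S : Set (Phase N)) (f : Pt1 → ℝ),
      0 < r → 0 ≤ τ → IsOneParticleDensity τ (condLaw (localGibbsLaw σ a₀ u₀ θ₀ N Φ) S) Φ f →
      ∀ x : T3, rhoBar r (condLaw (localGibbsLaw σ a₀ u₀ θ₀ N Φ) S) Φ 0 x =
        ∫ y : T3 × V3, cone r y.1 x * f (0, y) := by
  intro N σ τ r a₀ θ₀ u₀ Φ S f hr hτ hf x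
  have hGm : Measurable fun y : T3 × V3 => cone r y.1 x :=
    ((contactB_continuous_cone_left r x).comp continuous_fst).measurable
  have hGb : ∃ C : ℝ, ∀ y : T3 × V3, |cone r y.1 x| ≤ C :=
    ⟨3 / (Real.pi * r ^ 3), fun y => by
      rw [abs_of_nonneg (cone_nonneg hr y.1 x)]
      exact contactB_cone_le_const hr y.1 x⟩
  obtain ⟨-, he⟩ := contactB_onePt_zero _ Φ f hτ hf (contactB_flow_zero_ae_condLaw σ a₀ θ₀ u₀ Φ S) _ hGm hGb
  rw [contactB_rhoBar_zero, ← he]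
  refine integral_congr_ae (Eventually.of_forall fun z => ?_)
  show ∫ q, cone r q.1 x ∂(empiricalMeasure z) = (N + 1 : ℝ)⁻¹ * ∑ i : Fin (N + 1), cone r (z i).1 x
  rw [integral_empiricalMeasure]
  push_cast
  ring

end Summit.AtomisticToContinuum.HydrodynamicLimit.Theorems.LocalSecondLawContact

end
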